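import Summits.BirchSwinnertonDyer.BirchSwinnertonDyer.Theorems.ResidualThetaTransportAtTwoThetaLayerLambdaCongruenceAtTwoCurveMuUndepleted
import Summits.BirchSwinnertonDyer.BirchSwinnertonDyer.Theorems.ResidualThetaTransportAtTwoThetaLayerLambdaCongruenceAtTwoStarCruxGlue
import Summits.BirchSwinnertonDyer.BirchSwinnertonDyer.Theorems.ResidualThetaTransportAtTwoThetaLayerLambdaCongruenceAtTwoTwoExclusion
import Summits.BirchSwinnertonDyer.BirchSwinnertonDyer.Theorems.ResidualThetaTransportAtTwoThetaLayerLambdaCongruenceAtTwoPlusManin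
import Summits.BirchSwinnertonDyer.BirchSwinnertonDyer.Theorems.ResidualThetaTransportAtTwoThetaLayerLambdaCongruenceAtTwoResidualReduction
import Summits.BirchSwinnertonDyer.BirchSwinnertonDyer.Theorems.ResidualThetaTransportAtTwoSignedMuVanishingAtTwoPlusCuspSpanFlat
import Literature.NumberTheory.EllipticCurves.PAdicLFunctionDistributionProofs
import Literature.NumberTheory.EllipticCurves.PAdicLFunctionInterpolationHoldsProofs
import HarnessLib

/-!
# Crux `ThetaLayerLambdaCongruenceAtTwo` (stmt-BirchSwinnertonDyer-20688, route ResidualThetaTransportAtTwo), line `birth` v11: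
# the research stub (μ-W₀) of Kan⁺ IS the research stub FLAT of the sibling crux Kμ⁺ — `(μ-W₀)(W,f) ⟺ FLAT-at-(W,f)` —
# hence (μ-W₁) and THE CRUX from `FlatMuZeroAtTwo`

Width seat bsd-wall-rtt-p3-w2 g2 (`--supports stmt-BirchSwinnertonDyer-20688`; closes nothing). THEOREMS ONLY — no definition, no named
fact, no `sorry`; the two research statements are hypotheses spelled VERBATIM; nothing about any curve or form is asserted; BSD is
not proved by any of this.

STATE. Skeleton v11 of line `birth` (lead g7, 2026-08-28T06:16Z) = {PUB `stub_pubFactsKanPlus` (seven Literature facts),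
(μ-W₀) `stub_curvePlusSymbolMaxAtTwoPowerCusp`}: «for every habitat⁺ curve `W` and its newform `f`, the `2`-adic rational plus
symbol `[·]⁺_f` attains its maximum norm OVER `ℚ` at a `2`-power cusp `γ^s/2^{n₁+2}` of some EVEN layer `n₁`» (conjecture-grade;
`…CruxOfPlusSymbolMax`: crux ⟸ 7 facts + (μ-W₀); `…UndepletedMaxOfCuspSpan` (w3 g4): (μ-W₀)(W,f) ⟸ (G′)_{N_W} `CuspSpanEvenAtTwo`, a SUFFICIENT curve-free condition).
The sibling crux Kμ⁺ `SignedMuVanishingAtTwoPlus` (stmt-BirchSwinnertonDyer-20689) has the registered line stub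
`stub_flatMuZeroAtTwo : FlatMuZeroAtTwo` (`Cruxes/SignedMuVanishingAtTwoPlus/Lines/birth.lean`): «on the habitat⁺, `2 ∤ L♭` for
every Pollack pair of the newform at `2`».

WHAT THIS FILE PROVES.
* §1 (one rational newform `f`, odd level `N ≠ 1`, `a₂ = 0`) `exists_norm_ratPlusSymbol_eq_two`: SOME value `[r]⁺_f` has
  `|·|₂ = 2` exactly — the period `γ` with `re{∞, γ∞}_f = Ω⁺_f/2` (`…CuspSpanHecke.exists_re_cuspSymbol_eq_plusPeriod_half`) gives
  `[γ0]⁺_f = [0]⁺_f + ½` of norm `2` (`…CuspSpanFlat.norm_ratPlusSymbol_eq_two_of_odd`; `d(γ) ≠ 0` as `N ≠ 1`); and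
  `norm_map_ratPlusSymbol_le_two`: EVERY value has `|[r]⁺_f|₂ ≤ 2` (all cusp classes) — the period values are half-integers `m_γ/2`
  (`re Λ_f = ℤ·Ω⁺_f/2` + Manin's relation `…PlusManin.ratPlusSymbol_gamma0_smul`), a Manin–Drinfeld bound `2^{K+1}` (`K ≥ 1`)
  improves to `2^K` by lead g3's T₂-EXCLUSION `mem_of_gamma0_invariant_of_heckeTwo` on the closed ball of radius `2^K`
  (`T₂[·]⁺_f = a₂[·]⁺_f = 0`, `|2x|₂ = |x|₂/2`), descend to `K = 1` (the same bound, at the habitat level, is w3 g4's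
  `…UndepletedMaxOfCuspSpan.norm_ratPlusSymbol_le_two`, landed in parallel; here for any rational newform of odd level with `a₂ = 0`).
  So the maximum over `ℚ` IS `2`, attained at a period: (μ-W₀) is `μ = 0` in the cohomological normalisation, no boundary term.
* §2 (habitat⁺, one `(W, f)`) `plusSymbolMax_iff_exists_two_le_norm`: **(μ-W₀)(W,f) ⟺ «some `[5^s/2^{n+2}]⁺_f`, `n` even, has
  `|·|₂ ≥ 2`»** — the right side is VERBATIM the conclusion of Kμ⁺'s `SignedMuAtTwo.exists_two_le_norm_ratPlusSymbol_of_cuspSpan`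
  and the hypothesis of `SignedMuAtTwo.flatAtTwo_of_two_le_norm_ratPlusSymbol`; hence `flatAtTwo_of_plusSymbolMax`,
  `plusSymbolMax_of_flatAtTwo` and **`plusSymbolMax_iff_flatAtTwo` : (μ-W₀)(W,f) ⟺ FLAT-at-(W,f)** (the converse uses
  `analyticRank W = 0` only to HAVE a Pollack pair, `SignedMuAtTwo.flatAtTwo_iff_exists_norm_ratPlusSymbol_eq_two`).
* §3 (universal statements, VERBATIM texts) `curvePlusSymbolMax_iff_flatMuZeroAtTwo` : **(μ-W₀) of Kan⁺'s skeleton v11 ⟺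
  `FlatMuZeroAtTwo` of Kμ⁺'s skeleton**; `stub_curveDepletedSymbolMaxAtTwoPowerCusp_of_flatMuZeroAtTwo` : FLAT ⟹ the v10 stub (μ-W₁)
  VERBATIM (g7's `stub_curveDepletedSymbolMaxAtTwoPowerCusp_of_undepleted`); `thetaLayerLambdaCongruenceAtTwo_of_facts_flatMuZeroAtTwo_deligne` :
  **THE CRUX Kan⁺ BY NAME ⟸ the seven named facts + `FlatMuZeroAtTwo`**.

PLANNER READING. The promoted research item of Kan⁺ ((μ-W₀), lead g7's package) and the line stub FLAT of Kμ⁺ are ONE statement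
up to a kernel-checked `Iff` per `(W, f)`: every FLAT certificate of the `SignedMuAtTwo` files (odd `[0]⁺_f`, class instances,
(G′)_N) is a (μ-W₀)/(μ-W₁) certificate and conversely; one conjecture-grade node serves both cruxes. (21437, the NÉRON-normalised
analytic `μ`, is FLAT + the period-unit statement `PeriodUnitAtTwo`; that extra factor is not touched here.)

References: [MazurTateTeitelbaum1986Invent] §I.4 (4.2), §I.8, §I.13; [Pollack2003] Conj. 6.3, Prop. 6.18; [PollackWeston2011MT]
§3.1, Rem. 4.2; [Manin1972] Thm. 1.9; [CremonaAlgorithms1997] §2.8.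
-/

set_option autoImplicit false
-- justification: the `Summit.BirchSwinnertonDyer.BirchSwinnertonDyer.…` path repeats a component (route-file convention)
set_option linter.dupNamespace false

noncomputable section

open scoped Classical MatrixGroups

open CongruenceSubgroup Literature.NumberTheory.EllipticCurves Literature.NumberTheory.EllipticCurves.ModularForms

namespace Summit.BirchSwinnertonDyer.BirchSwinnertonDyer.Theorems.ThetaLayerLambdaCongruenceAtTwo

/-! ## §1. One rational newform: some value of `[·]⁺_f` has `2`-adic norm exactly `2` -/

section OneForm

variable {N : ℕ} [NeZero N] {f : CuspForm (Gamma0 N) 2}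

omit [NeZero N] in
/-- For `N ≠ 1` the lower-right entry of an element of `Γ₀(N)` is non-zero (it is a unit mod `N`). [folklore] -/
theorem gamma0_apply_one_one_ne_zero (hN1 : N ≠ 1) (γ : Gamma0 N) : (γ : SL(2, ℤ)) 1 1 ≠ 0 := fun hd ↦ by
  have h := SignedMuAtTwo.isUnit_gamma0_apply_one_one γ
  rw [hd, Int.cast_zero, isUnit_zero_iff] at h
  exact hN1 (ZMod.subsingleton_iff.mp (subsingleton_of_zero_eq_one h))

/-- **The period values of `[·]⁺_f` are half-integers**: for a rational newform `f` of level `N ≠ 1` and `γ = (a b; c d) ∈ Γ₀(N)`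
with `c ≠ 0`, `[a/c]⁺_f = [γ0]⁺_f − [0]⁺_f = m_γ/2` with `m_γ = 2 re{∞, γ∞}_f/Ω⁺_f ∈ ℤ` (Manin's relation at the cusp `0`, and
`re Λ_f = ℤ·Ω⁺_f/2`). [cite: Manin1972, Thm. 1.9] [cite: MazurTateTeitelbaum1986Invent, §I.8] -/
theorem exists_ratPlusSymbol_maninCusp_eq_intCast_div_two (hf : IsNewform0 f) (hQ : coeffField f = ⊥) (hN1 : N ≠ 1)
    (γ : Gamma0 N) (hc : (γ : SL(2, ℤ)) 1 0 ≠ 0) :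
    ∃ m : ℤ, (cuspSymbol f γ).re = m * (plusPeriod f / 2) ∧
      ratPlusSymbol f ((((γ : SL(2, ℤ)) 0 0 : ℚ)) / (((γ : SL(2, ℤ)) 1 0 : ℚ))) = (m : ℚ) / 2 := by
  have hΩ : plusPeriod f ≠ 0 := (IsNewform0.plusPeriod_pos_holds hf hQ).ne'
  have hd : (γ : SL(2, ℤ)) 1 1 ≠ 0 := gamma0_apply_one_one_ne_zero hN1 γ
  obtain ⟨m, hm⟩ := SignedMuAtTwo.exists_int_re_cuspSymbol_eq f hΩ γ
  refine ⟨m, hm, ?_⟩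
  have h1 := SignedMuAtTwo.ratPlusSymbol_apply_div_eq_add_half f hf hQ γ hd hm
  have h2 := ratPlusSymbol_gamma0_smul hf hQ γ 0 (by rw [mul_zero, zero_add]; exact_mod_cast hd)
  simp only [mul_zero, zero_add, if_neg hc] at h2
  linear_combination h1 - h2

/-- **A-priori bound (Manin–Drinfeld).** `|[r]⁺_f|₂ ≤ 2^{K+1}` for all `r ∈ ℚ`, for some `K` (the `[r]⁺_f` have a common
denominator). [cite: Manin1972, Cor. 3.6] -/
theorem exists_forall_norm_map_ratPlusSymbol_le_two_pow (f : CuspForm (Gamma0 N) 2) :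
    ∃ K : ℕ, ∀ r : ℚ, ‖algebraMap ℚ (PadicAlgCl 2) (ratPlusSymbol f r)‖ ≤ 2 ^ (K + 1) := by
  obtain ⟨D, hDpos, hD⟩ := exists_forall_ratPlusSymbol_eq_div_of_maninDrinfeld
    (exists_nsmul_modularSymbol_mem_periodLattice_holds f)
  have hD0 : (D : PadicAlgCl 2) ≠ 0 := by exact_mod_cast hDpos.ne'
  have hDn : 0 < ‖(D : PadicAlgCl 2)‖ := norm_pos_iff.mpr hD0
  obtain ⟨K, hK⟩ := pow_unbounded_of_one_lt (‖(D : PadicAlgCl 2)‖⁻¹) (one_lt_two : (1 : ℝ) < 2)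
  refine ⟨K, fun r ↦ ?_⟩
  obtain ⟨m, hm⟩ := hD r
  rw [hm, map_div₀, map_intCast, map_natCast, norm_div]
  calc ‖(m : PadicAlgCl 2)‖ / ‖(D : PadicAlgCl 2)‖ ≤ 1 / ‖(D : PadicAlgCl 2)‖ := by
        gcongr; exact norm_intCast_padicAlgCl_two_le_one m
    _ = ‖(D : PadicAlgCl 2)‖⁻¹ := one_div _
    _ ≤ 2 ^ K := hK.le
    _ ≤ 2 ^ (K + 1) := pow_le_pow_right₀ one_le_two (Nat.le_succ K)

/-- **T₂ with `a₂ = 0` on `[·]⁺_f`**: `[x/2]⁺_f + [(x+1)/2]⁺_f + [2x]⁺_f = 0`, read in `ℚ̄₂` (Mazur–Tate–Teitelbaum (4.2)).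
[cite: MazurTateTeitelbaum1986Invent, §I.4 (4.2)] -/
theorem heckeTwo_map_ratPlusSymbol_eq_zero (hf : IsNewform0 f) (hQ : coeffField f = ⊥) (h2N : ¬ 2 ∣ N)
    (ha₂ : cuspCoeff f 2 = 0) (x : ℚ) :
    (∑ j : Fin 2, algebraMap ℚ (PadicAlgCl 2) (ratPlusSymbol f ((x + j) / 2))) +
      algebraMap ℚ (PadicAlgCl 2) (ratPlusSymbol f (2 * x)) = 0 := by
  have h := intCast_mul_ratPlusSymbol (p := 2) hf Nat.prime_two h2N (ap := 0) (by rw [ha₂]; simp)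
    (ratCast_ratPlusSymbol_holds hf hQ) x
  push_cast at h
  rw [zero_mul] at h
  have h' := congrArg (algebraMap ℚ (PadicAlgCl 2)) h
  rw [map_zero, map_add, map_sum] at h'
  exact h'.symm

/-- **The `2`-adic maximum of `[·]⁺_f` over `ℚ` is at most `|½|₂ = 2`** (rational newform, odd level `N ≠ 1`, `a₂ = 0`): for EVERY
`r ∈ ℚ`, `|[r]⁺_f|₂ ≤ 2`. Descent `2^{K+1} → 2^K` (`K ≥ 1`) by T₂-exclusion (`mem_of_gamma0_invariant_of_heckeTwo`) for the closed
ball of radius `2^K`: `[·]⁺_f` is `Γ₀(N)`-invariant modulo its period values `m_γ/2` (norm `≤ 2`), `T₂[·]⁺_f = 0`, and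
`|2·[y]⁺_f|₂ = |[y]⁺_f|₂/2 ≤ 2^K`. So no cusp of `X₀(N)` carries a `2`-power denominator beyond the forced `½`: `T₂ ∈ 𝔪` excludes
every boundary (Eisenstein) contribution mod `2`. [cite: Manin1972, Thm. 1.9] [cite: MazurTateTeitelbaum1986Invent, §I.4 (4.2), §I.8] -/
theorem norm_map_ratPlusSymbol_le_two (hf : IsNewform0 f) (hQ : coeffField f = ⊥) (h2N : ¬ 2 ∣ N) (hN1 : N ≠ 1)
    (ha₂ : cuspCoeff f 2 = 0) (r : ℚ) : ‖algebraMap ℚ (PadicAlgCl 2) (ratPlusSymbol f r)‖ ≤ 2 := by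
  have hN : Odd N := Nat.odd_iff.mpr (Nat.two_dvd_ne_zero.mp h2N)
  -- `‖2‖ = 2⁻¹` and `‖m/2‖ ≤ 2` in `ℚ̄₂`
  have htwo : ‖(2 : PadicAlgCl 2)‖ = (2 : ℝ)⁻¹ := by
    rw [show (2 : PadicAlgCl 2) = ((2 : ℕ) : PadicAlgCl 2) by norm_num,
      ← map_natCast (algebraMap ℚ_[2] (PadicAlgCl 2)) 2]
    change ‖(((2 : ℕ) : ℚ_[2]) : PadicAlgCl 2)‖ = (2 : ℝ)⁻¹
    rw [PadicAlgCl.norm_extends, Padic.norm_p]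
    norm_num
  have hhalf : ∀ m : ℤ, ‖algebraMap ℚ (PadicAlgCl 2) ((m : ℚ) / 2)‖ ≤ 2 := fun m ↦ by
    rw [map_div₀, map_intCast, map_ofNat, norm_div, htwo, div_inv_eq_mul]
    linarith [norm_intCast_padicAlgCl_two_le_one m]
  -- `P k`: the bound `2^{k+1}`
  have step : ∀ k : ℕ, (∀ r : ℚ, ‖algebraMap ℚ (PadicAlgCl 2) (ratPlusSymbol f r)‖ ≤ 2 ^ (k + 1 + 1)) →
      ∀ r : ℚ, ‖algebraMap ℚ (PadicAlgCl 2) (ratPlusSymbol f r)‖ ≤ 2 ^ (k + 1) := by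
    intro k hk
    let S : AddSubgroup (PadicAlgCl 2) :=
      { carrier := {z | ‖z‖ ≤ 2 ^ (k + 1)}
        add_mem' := fun {x y} hx hy ↦ (IsUltrametricDist.norm_add_le_max x y).trans (max_le hx hy)
        zero_mem' := by simp
        neg_mem' := fun {x} hx ↦ by simpa using hx }
    have hS : ∀ z : PadicAlgCl 2, z ∈ S ↔ ‖z‖ ≤ 2 ^ (k + 1) := fun z ↦ Iff.rfl
    have h2k : (2 : ℝ) ≤ 2 ^ (k + 1) := by
      calc (2 : ℝ) = 2 ^ 1 := (pow_one _).symm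
        _ ≤ 2 ^ (k + 1) := pow_le_pow_right₀ one_le_two (by omega)
    have h := mem_of_gamma0_invariant_of_heckeTwo hN (fun x ↦ algebraMap ℚ (PadicAlgCl 2) (ratPlusSymbol f x)) S
      (fun γ r hr ↦ by
        have e := map_ratPlusSymbol_gamma0_smul hf hQ (algebraMap ℚ (PadicAlgCl 2)) γ r hr
        simp only at e
        rw [e, add_sub_cancel_right]
        by_cases hc : (γ : SL(2, ℤ)) 1 0 = 0
        · rw [if_pos hc]; exact S.zero_mem
        · rw [if_neg hc, hS]
          obtain ⟨m, -, hm⟩ := exists_ratPlusSymbol_maninCusp_eq_intCast_div_two hf hQ hN1 γ hc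
          simp only [hm]
          exact (hhalf m).trans h2k)
      (fun x ↦ by rw [heckeTwo_map_ratPlusSymbol_eq_zero hf hQ h2N ha₂ x]; exact S.zero_mem)
      (fun y ↦ (hS _).mpr (by
        rw [nsmul_eq_mul, Nat.cast_ofNat, norm_mul, htwo]
        have h1 := hk y
        have e : (2 : ℝ) ^ (k + 1 + 1) = 2 * 2 ^ (k + 1) := by ring
        rw [e] at h1
        linarith))
    intro r
    exact (hS _).mp (h r)
  obtain ⟨K, hK⟩ := exists_forall_norm_map_ratPlusSymbol_le_two_pow f
  have down : ∀ k : ℕ, (∀ r : ℚ, ‖algebraMap ℚ (PadicAlgCl 2) (ratPlusSymbol f r)‖ ≤ 2 ^ (k + 1)) →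
      ∀ r : ℚ, ‖algebraMap ℚ (PadicAlgCl 2) (ratPlusSymbol f r)‖ ≤ 2 ^ (0 + 1) := by
    intro k
    induction k with
    | zero => exact id
    | succ k ih => exact fun h ↦ ih (step k h)
  simpa using down K hK r

/-- **Some value of `[·]⁺_f` is a genuine half-integer `2`-adically**: for a rational newform `f` of odd level `N ≠ 1` with
`a₂ = 0` there is `r ∈ ℚ` with `|[r]⁺_f|₂ = 2` — namely `r = γ0` for a period `γ ∈ Γ₀(N)` with `re{∞, γ∞}_f = Ω⁺_f/2`
(`Ω⁺_f/2` generates `re Λ_f`), where `[γ0]⁺_f = [0]⁺_f + ½` and `3[0]⁺_f ∈ ℤ`. [cite: MazurTateTeitelbaum1986Invent, §I.8]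
[cite: CremonaAlgorithms1997, §2.8] -/
theorem exists_norm_ratPlusSymbol_eq_two (hf : IsNewform0 f) (hQ : coeffField f = ⊥) (h2N : ¬ 2 ∣ N) (hN1 : N ≠ 1)
    (ha₂ : cuspCoeff f 2 = 0) : ∃ r : ℚ, ‖((ratPlusSymbol f r : ℚ) : ℚ_[2])‖ = 2 := by
  have hΩ : plusPeriod f ≠ 0 := (IsNewform0.plusPeriod_pos_holds hf hQ).ne'
  obtain ⟨γ, hγ⟩ := SignedMuAtTwo.exists_re_cuspSymbol_eq_plusPeriod_half f hΩ
  exact ⟨_, SignedMuAtTwo.norm_ratPlusSymbol_eq_two_of_odd f hf hQ h2N ha₂ γ (gamma0_apply_one_one_ne_zero hN1 γ)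
    (m := 1) odd_one (by rw [hγ]; push_cast; ring)⟩

end OneForm

/-! ## §2. The habitat⁺, one `(W, f)`: (μ-W₀)(W,f) ⟺ one layer symbol of norm `≥ 2` ⟺ FLAT-at-(W,f) -/

section Habitat

variable {W : WeierstrassCurve ℚ} [W.IsElliptic] [W.IsGloballyMinimal]

/-- On the habitat the newform has `a₂ = 0` as a cusp-form coefficient. [folklore] -/
theorem cuspCoeff_two_eq_zero_of_isNewformOf [NeZero (W.conductorNorm ℤ)] {f : CuspForm (Gamma0 (W.conductorNorm ℤ)) 2}
    (hf : IsNewformOf W f) (hss : Rank1Residual.GoodSS W 2) (ha : W.frobeniusTrace 2 = 0) : cuspCoeff f 2 = 0 := by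
  rw [hf.2 2, W.LFunction_apply_prime_eq_frobeniusTrace 2 hss.1, ha]; simp

/-- **`|[r]⁺_f|₂ ≤ 2` for every `r ∈ ℚ`** on the habitat⁺ (`W` good supersingular at `2`, `a₂(W) = 0`, `f` its newform; `N_W ≠ 1`).
[cite: MazurTateTeitelbaum1986Invent, §I.4 (4.2) and §I.8] -/
theorem norm_map_ratPlusSymbol_le_two_of_isNewformOf [NeZero (W.conductorNorm ℤ)]
    {f : CuspForm (Gamma0 (W.conductorNorm ℤ)) 2} (hf : IsNewformOf W f) (hss : Rank1Residual.GoodSS W 2)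
    (ha : W.frobeniusTrace 2 = 0) (r : ℚ) : ‖algebraMap ℚ (PadicAlgCl 2) (ratPlusSymbol f r)‖ ≤ 2 :=
  norm_map_ratPlusSymbol_le_two hf.1 hf.coeffField_eq_bot (SignedMuAtTwo.not_two_dvd_conductorNorm_of_goodSS hss)
    (WeierstrassCurve.conductorNorm_ne_one W) (cuspCoeff_two_eq_zero_of_isNewformOf hf hss ha) r

/-- **On the habitat⁺ some `[r]⁺_f` has `|·|₂ = 2`, and this is the maximum over `ℚ`** (upper bound: w3 g4's
`norm_ratPlusSymbol_le_two`). [cite: MazurTateTeitelbaum1986Invent, §I.8] -/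
theorem exists_norm_ratPlusSymbol_eq_two_of_isNewformOf [NeZero (W.conductorNorm ℤ)]
    {f : CuspForm (Gamma0 (W.conductorNorm ℤ)) 2} (hf : IsNewformOf W f) (hss : Rank1Residual.GoodSS W 2)
    (ha : W.frobeniusTrace 2 = 0) :
    ∃ r₀ : ℚ, ‖algebraMap ℚ (PadicAlgCl 2) (ratPlusSymbol f r₀)‖ = 2 ∧
      ∀ r : ℚ, ‖algebraMap ℚ (PadicAlgCl 2) (ratPlusSymbol f r)‖ ≤ ‖algebraMap ℚ (PadicAlgCl 2) (ratPlusSymbol f r₀)‖ := by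
  obtain ⟨r₀, hr₀⟩ := exists_norm_ratPlusSymbol_eq_two hf.1 hf.coeffField_eq_bot
    (SignedMuAtTwo.not_two_dvd_conductorNorm_of_goodSS hss) (WeierstrassCurve.conductorNorm_ne_one W)
    (cuspCoeff_two_eq_zero_of_isNewformOf hf hss ha)
  rw [← SignedMuAtTwo.norm_algebraMap_rat_padicAlgCl] at hr₀
  exact ⟨r₀, hr₀, fun r ↦ hr₀ ▸ norm_map_ratPlusSymbol_le_two_of_isNewformOf hf hss ha r⟩

/-- **(μ-W₀) normal form at `(W, f)`**: «`[·]⁺_f` attains its `2`-adic maximum over `ℚ` at `r₀`» ⟺ «`|[r₀]⁺_f|₂ ≥ 2`» (⟺ `= 2`):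
the maximum over `ℚ` is the PERIOD maximum `|½|₂` — (μ-W₀) is `μ = 0` in the cohomological (Pollack–Weston) normalisation, with no
boundary contribution from any cusp of `X₀(N_W)`. [cite: PollackWeston2011MT, §3.1 and Rem. 4.2] -/
theorem isMax_norm_ratPlusSymbol_iff_two_le [NeZero (W.conductorNorm ℤ)]
    {f : CuspForm (Gamma0 (W.conductorNorm ℤ)) 2} (hf : IsNewformOf W f) (hss : Rank1Residual.GoodSS W 2)
    (ha : W.frobeniusTrace 2 = 0) (r₀ : ℚ) :
    (∀ r : ℚ, ‖algebraMap ℚ (PadicAlgCl 2) (ratPlusSymbol f r)‖ ≤ ‖algebraMap ℚ (PadicAlgCl 2) (ratPlusSymbol f r₀)‖) ↔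
      2 ≤ ‖((ratPlusSymbol f r₀ : ℚ) : ℚ_[2])‖ := by
  rw [← SignedMuAtTwo.norm_algebraMap_rat_padicAlgCl]
  constructor
  · intro h
    obtain ⟨r₁, hr₁, -⟩ := exists_norm_ratPlusSymbol_eq_two_of_isNewformOf hf hss ha
    exact hr₁ ▸ h r₁
  · exact fun h r ↦ (norm_map_ratPlusSymbol_le_two_of_isNewformOf hf hss ha r).trans h

/-- **(μ-W₀)(W,f) ⟺ «some `[5^s/2^{n+2}]⁺_f`, `n` even, has `|·|₂ ≥ 2`»** — left side VERBATIM the hypothesis `hμ0` of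
`curveDepletedSymbolMax_of_plusSymbolMax` (lead g7) / conclusion of `undepletedMax_of_cuspSpanEvenAtTwo` (w3 g4); right side VERBATIM
the conclusion of `SignedMuAtTwo.exists_two_le_norm_ratPlusSymbol_of_cuspSpan` / hypothesis of
`SignedMuAtTwo.flatAtTwo_of_two_le_norm_ratPlusSymbol` (crux Kμ⁺). [cite: PollackWeston2011MT, §3.1] [cite: Pollack2003, Prop. 6.18] -/
theorem plusSymbolMax_iff_exists_two_le_norm [NeZero (W.conductorNorm ℤ)]
    {f : CuspForm (Gamma0 (W.conductorNorm ℤ)) 2} (hf : IsNewformOf W f) (hss : Rank1Residual.GoodSS W 2)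
    (ha : W.frobeniusTrace 2 = 0) :
    (∃ n₁ : ℕ, Even n₁ ∧ ∃ s : ZMod (2 ^ n₁), ∀ r : ℚ, ‖algebraMap ℚ (PadicAlgCl 2) (ratPlusSymbol f r)‖ ≤ ‖algebraMap ℚ (PadicAlgCl 2) (ratPlusSymbol f ((((Literature.NumberTheory.EllipticCurves.cyclotomicGenerator 2 : ZMod (2 ^ (n₁ + 2))) ^ s.val).val : ℚ) / (2 : ℚ) ^ (n₁ + 2)))‖) ↔
      ∃ n : ℕ, Even n ∧ ∃ s : ZMod (2 ^ n),
        2 ≤ ‖((ratPlusSymbol f ((((cyclotomicGenerator 2 : ZMod (2 ^ (n + 2))) ^ s.val).val : ℚ) /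
          (2 : ℚ) ^ (n + 2)) : ℚ) : ℚ_[2])‖ := by
  constructor
  · rintro ⟨n, hn, s, h⟩
    exact ⟨n, hn, s, (isMax_norm_ratPlusSymbol_iff_two_le hf hss ha _).mp h⟩
  · rintro ⟨n, hn, s, h⟩
    exact ⟨n, hn, s, (isMax_norm_ratPlusSymbol_iff_two_le hf hss ha _).mpr h⟩

/-- **(μ-W₀)(W,f) ⟹ FLAT-at-(W,f)** («`2 ∤ L♭` for every Pollack pair of `f` at `2`», Kμ⁺'s line stub at `(W,f)`), by
`SignedMuAtTwo.flatAtTwo_of_two_le_norm_ratPlusSymbol`. [cite: Pollack2003, Prop. 6.18] [cite: PollackWeston2011MT, §3.1] -/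
theorem flatAtTwo_of_plusSymbolMax [NeZero (W.conductorNorm ℤ)]
    {f : CuspForm (Gamma0 (W.conductorNorm ℤ)) 2} (hf : IsNewformOf W f) (hss : Rank1Residual.GoodSS W 2)
    (ha : W.frobeniusTrace 2 = 0) (hμ0 : ∃ n₁ : ℕ, Even n₁ ∧ ∃ s : ZMod (2 ^ n₁), ∀ r : ℚ, ‖algebraMap ℚ (PadicAlgCl 2) (ratPlusSymbol f r)‖ ≤ ‖algebraMap ℚ (PadicAlgCl 2) (ratPlusSymbol f ((((Literature.NumberTheory.EllipticCurves.cyclotomicGenerator 2 : ZMod (2 ^ (n₁ + 2))) ^ s.val).val : ℚ) / (2 : ℚ) ^ (n₁ + 2)))‖) :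
    ∀ Lplus Lminus : IwasawaAlgebra 2, Summit.BirchSwinnertonDyer.Rank1Residual.Supersingular.IsPollackPair f 2 Lplus Lminus → ¬ PowerSeries.C (2 : ℤ_[2]) ∣ Lminus := by
  obtain ⟨n, hn, s, hs⟩ := (plusSymbolMax_iff_exists_two_le_norm hf hss ha).mp hμ0
  exact SignedMuAtTwo.flatAtTwo_of_two_le_norm_ratPlusSymbol hn hs

/-- **FLAT-at-(W,f) ⟹ (μ-W₀)(W,f)** on the habitat⁺ (`analyticRank W = 0` only supplies a Pollack pair,
`SignedMuAtTwo.flatAtTwo_iff_exists_norm_ratPlusSymbol_eq_two`): every FLAT certificate of the `SignedMuAtTwo` files is a (μ-W₀)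
certificate for line `birth` of Kan⁺. [cite: Pollack2003, Prop. 6.18] [cite: PollackWeston2011MT, §3.1 and Rem. 4.2] -/
theorem plusSymbolMax_of_flatAtTwo [NeZero (W.conductorNorm ℤ)]
    {f : CuspForm (Gamma0 (W.conductorNorm ℤ)) 2} (hf : IsNewformOf W f) (hss : Rank1Residual.GoodSS W 2)
    (ha : W.frobeniusTrace 2 = 0) (hr : W.analyticRank = 0) (hflat : ∀ Lplus Lminus : IwasawaAlgebra 2, Summit.BirchSwinnertonDyer.Rank1Residual.Supersingular.IsPollackPair f 2 Lplus Lminus → ¬ PowerSeries.C (2 : ℤ_[2]) ∣ Lminus) :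
    ∃ n₁ : ℕ, Even n₁ ∧ ∃ s : ZMod (2 ^ n₁), ∀ r : ℚ, ‖algebraMap ℚ (PadicAlgCl 2) (ratPlusSymbol f r)‖ ≤ ‖algebraMap ℚ (PadicAlgCl 2) (ratPlusSymbol f ((((Literature.NumberTheory.EllipticCurves.cyclotomicGenerator 2 : ZMod (2 ^ (n₁ + 2))) ^ s.val).val : ℚ) / (2 : ℚ) ^ (n₁ + 2)))‖ := by
  obtain ⟨n, hn, s, hs⟩ := (SignedMuAtTwo.flatAtTwo_iff_exists_norm_ratPlusSymbol_eq_two hf hss ha hr).mp hflat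
  exact (plusSymbolMax_iff_exists_two_le_norm hf hss ha).mpr ⟨n, hn, s, hs.ge⟩

/-- **(μ-W₀)(W,f) ⟺ FLAT-at-(W,f)** on the habitat⁺: the research stub of Kan⁺'s line `birth` v11 and the research stub of Kμ⁺'s
line `birth`, read at one `(W, f)`, are the same statement. [cite: Pollack2003, Conj. 6.3 and Prop. 6.18]
[cite: PollackWeston2011MT, §3.1 and Rem. 4.2] -/
theorem plusSymbolMax_iff_flatAtTwo [NeZero (W.conductorNorm ℤ)]
    {f : CuspForm (Gamma0 (W.conductorNorm ℤ)) 2} (hf : IsNewformOf W f) (hss : Rank1Residual.GoodSS W 2)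
    (ha : W.frobeniusTrace 2 = 0) (hr : W.analyticRank = 0) :
    (∃ n₁ : ℕ, Even n₁ ∧ ∃ s : ZMod (2 ^ n₁), ∀ r : ℚ, ‖algebraMap ℚ (PadicAlgCl 2) (ratPlusSymbol f r)‖ ≤ ‖algebraMap ℚ (PadicAlgCl 2) (ratPlusSymbol f ((((Literature.NumberTheory.EllipticCurves.cyclotomicGenerator 2 : ZMod (2 ^ (n₁ + 2))) ^ s.val).val : ℚ) / (2 : ℚ) ^ (n₁ + 2)))‖) ↔ ∀ Lplus Lminus : IwasawaAlgebra 2, Summit.BirchSwinnertonDyer.Rank1Residual.Supersingular.IsPollackPair f 2 Lplus Lminus → ¬ PowerSeries.C (2 : ℤ_[2]) ∣ Lminus :=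
  ⟨flatAtTwo_of_plusSymbolMax hf hss ha, plusSymbolMax_of_flatAtTwo hf hss ha hr⟩

/-- **FLAT-at-(W,f) ⟹ (μ-W₁)(W,f,S₀) for every finite set `S₀` of odd places** (the conclusion of the v10 stub
`stub_curveDepletedSymbolMaxAtTwoPowerCusp` at `(W, f, S₀)`), through lead g7's `curveDepletedSymbolMax_of_plusSymbolMax`.
[cite: Pollack2003, Prop. 6.18] [cite: GreenbergVatsal2000, §1 (10)] -/
theorem curveDepletedSymbolMax_of_flatAtTwo [NeZero (W.conductorNorm ℤ)]
    {f : CuspForm (Gamma0 (W.conductorNorm ℤ)) 2} (hf : IsNewformOf W f) (hss : Rank1Residual.GoodSS W 2)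
    (ha : W.frobeniusTrace 2 = 0) (hr : W.analyticRank = 0) (hflat : ∀ Lplus Lminus : IwasawaAlgebra 2, Summit.BirchSwinnertonDyer.Rank1Residual.Supersingular.IsPollackPair f 2 Lplus Lminus → ¬ PowerSeries.C (2 : ℤ_[2]) ∣ Lminus)
    (S₀ : Finset (IsDedekindDomain.HeightOneSpectrum (NumberField.RingOfIntegers ℚ)))
    (hS2 : ∀ v ∈ S₀, ((2 : ℕ) : NumberField.RingOfIntegers ℚ) ∉ v.asIdeal) :
    ∃ n₁ : ℕ, Even n₁ ∧ ∃ s : ZMod (2 ^ n₁), ∀ r : ℚ, ‖(∑ k ∈ Fintype.piFinset (fun _ : S₀ ↦ Finset.range 3), (∏ v : S₀, ((W.localPolynomialAt (v : IsDedekindDomain.HeightOneSpectrum (NumberField.RingOfIntegers ℚ))).map (Int.castRingHom (PadicAlgCl 2))).coeff (k v) * ((Rat.HeightOneSpectrum.natGenerator (v : IsDedekindDomain.HeightOneSpectrum (NumberField.RingOfIntegers ℚ)) : PadicAlgCl 2)⁻¹) ^ (k v)) * algebraMap ℚ (PadicAlgCl 2) (ratPlusSymbol f (r * ((∏ v : S₀,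 Rat.HeightOneSpectrum.natGenerator (v : IsDedekindDomain.HeightOneSpectrum (NumberField.RingOfIntegers ℚ)) ^ (k v) : ℕ) : ℚ))))‖ ≤ ‖(∑ k ∈ Fintype.piFinset (fun _ : S₀ ↦ Finset.range 3), (∏ v : S₀, ((W.localPolynomialAt (v : IsDedekindDomain.HeightOneSpectrum (NumberField.RingOfIntegers ℚ))).map (Int.castRingHom (PadicAlgCl 2))).coeff (k v) * ((Rat.HeightOneSpectrum.natGenerator (v : IsDedekindDomain.HeightOneSpectrum (NumberField.RingOfIntegers ℚ)) : PadicAlgCl 2)⁻¹) ^ (k v)) * algebraMap ℚ (PadicAlgCl 2) (ratPlusSymbol f ((((((Literature.NumberTheory.EllipticCurves.cyclotomicGenerator 2 : ZMod (2 ^ (n₁ + 2))) ^ s.val).val : ℚ) / (2 : ℚ) ^ (n₁ + 2))) * ((∏ v : S₀, Rat.HeightOneSpectrum.natGenerator (v : IsDedekindDomain.HeightOneSpectrum (NumberField.RingOfIntegers ℚ)) ^ (k v) : ℕ) : ℚ))))‖ :=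
  curveDepletedSymbolMax_of_plusSymbolMax hss ha hf (plusSymbolMax_of_flatAtTwo hf hss ha hr hflat) S₀ hS2

end Habitat

/-! ## §3. The universal statements: (μ-W₀) of Kan⁺ v11 ⟺ `FlatMuZeroAtTwo` of Kμ⁺; (μ-W₁) and THE CRUX from `FlatMuZeroAtTwo` -/

section Universal

/-- **Kan⁺'s v11 research stub (μ-W₀) `stub_curvePlusSymbolMaxAtTwoPowerCusp` ⟺ Kμ⁺'s research stub `FlatMuZeroAtTwo`**, both texts
VERBATIM (`Cruxes/ThetaLayerLambdaCongruenceAtTwo/Lines/birth.lean` v11; `Cruxes/SignedMuVanishingAtTwoPlus/Lines/birth.lean`): ONE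
conjecture-grade node for the two cruxes. [cite: Pollack2003, Conj. 6.3] [cite: PollackWeston2011MT, Rem. 4.2] -/
theorem curvePlusSymbolMax_iff_flatMuZeroAtTwo :
    (∀ (W : WeierstrassCurve ℚ) [W.IsElliptic] [W.IsGloballyMinimal], ¬ W.HasCM → W.analyticRank = 0 → Literature.NumberTheory.EllipticCurves.Rank1Residual.GoodSS W 2 → W.frobeniusTrace 2 = 0 → W.Δ < 0 → ∀ [NeZero (W.conductorNorm ℤ)] (f : CuspForm (CongruenceSubgroup.Gamma0 (W.conductorNorm ℤ)) 2), Literature.NumberTheory.EllipticCurves.ModularForms.IsNewformOf W f → ∃ n₁ : ℕ, Even n₁ ∧ ∃ s : ZMod (2 ^ n₁), ∀ r : ℚ, ‖algebraMap ℚ (PadicAlgCl 2) (Literature.NumberTheory.EllipticCurves.ratPlusSymbol f r)‖ ≤ ‖algebraMap ℚ (PadicAlgCl 2) (Literature.NumberTheory.EllipticCurves.ratPlusSymbol f (((((Literature.NumberTheory.EllipticCurves.cyclotomicGenerator 2 : ZMod (2 ^ (n₁ + 2))) ^ s.val).val : ℚ) / (2 : ℚ) ^ (n₁ + 2))))‖)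 ↔
    (∀ (W : WeierstrassCurve ℚ) [W.IsElliptic] [W.IsGloballyMinimal], ¬ W.HasCM → W.analyticRank = 0 → Literature.NumberTheory.EllipticCurves.Rank1Residual.GoodSS W 2 → W.frobeniusTrace 2 = 0 → W.Δ < 0 → ∀ [NeZero (W.conductorNorm ℤ)] (f : CuspForm (CongruenceSubgroup.Gamma0 (W.conductorNorm ℤ)) 2), Literature.NumberTheory.EllipticCurves.ModularForms.IsNewformOf W f → ∀ (Lplus Lminus : Literature.NumberTheory.EllipticCurves.IwasawaAlgebra 2), Summit.BirchSwinnertonDyer.Rank1Residual.Supersingular.IsPollackPair f 2 Lplus Lminus → ¬ PowerSeries.C (2 : ℤ_[2]) ∣ Lminus) :=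
  ⟨fun h W _ _ hcm hr hss ha hΔ _ f hf ↦ flatAtTwo_of_plusSymbolMax hf hss ha (h W hcm hr hss ha hΔ f hf),
    fun h W _ _ hcm hr hss ha hΔ _ f hf ↦ plusSymbolMax_of_flatAtTwo hf hss ha hr (h W hcm hr hss ha hΔ f hf)⟩

/-- **`FlatMuZeroAtTwo` ⟹ the v10 stub (μ-W₁) `stub_curveDepletedSymbolMaxAtTwoPowerCusp` VERBATIM** (through §3 and lead g7's
`stub_curveDepletedSymbolMaxAtTwoPowerCusp_of_undepleted`). [cite: Pollack2003, Conj. 6.3] [cite: GreenbergVatsal2000, §1 (10)] -/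
theorem stub_curveDepletedSymbolMaxAtTwoPowerCusp_of_flatMuZeroAtTwo
    (hflat : ∀ (W : WeierstrassCurve ℚ) [W.IsElliptic] [W.IsGloballyMinimal], ¬ W.HasCM → W.analyticRank = 0 → Literature.NumberTheory.EllipticCurves.Rank1Residual.GoodSS W 2 → W.frobeniusTrace 2 = 0 → W.Δ < 0 → ∀ [NeZero (W.conductorNorm ℤ)] (f : CuspForm (CongruenceSubgroup.Gamma0 (W.conductorNorm ℤ)) 2), Literature.NumberTheory.EllipticCurves.ModularForms.IsNewformOf W f → ∀ (Lplus Lminus : Literature.NumberTheory.EllipticCurves.IwasawaAlgebra 2), Summit.BirchSwinnertonDyer.Rank1Residual.Supersingular.IsPollackPair f 2 Lplus Lminus → ¬ PowerSeries.C (2 : ℤ_[2]) ∣ Lminus) :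
    ∀ (W : WeierstrassCurve ℚ) [W.IsElliptic] [W.IsGloballyMinimal], ¬ W.HasCM → W.analyticRank = 0 → Literature.NumberTheory.EllipticCurves.Rank1Residual.GoodSS W 2 → W.frobeniusTrace 2 = 0 → W.Δ < 0 → ∀ [NeZero (W.conductorNorm ℤ)] (f : CuspForm (CongruenceSubgroup.Gamma0 (W.conductorNorm ℤ)) 2), Literature.NumberTheory.EllipticCurves.ModularForms.IsNewformOf W f → ∀ (S₀ : Finset (IsDedekindDomain.HeightOneSpectrum (NumberField.RingOfIntegers ℚ))), (∀ v ∈ S₀, ((2 : ℕ) : NumberField.RingOfIntegers ℚ) ∉ v.asIdeal) → (∀ v : IsDedekindDomain.HeightOneSpectrum (NumberField.RingOfIntegers ℚ), ¬ W.HasGoodReductionAt v → v ∈ S₀) → ∃ n₁ : ℕ, Even n₁ ∧ ∃ s : ZMod (2 ^ n₁), ∀ r : ℚ, ‖(∑ k ∈ Fintype.piFinset (fun _ : S₀ ↦ Finset.range 3), (∏ v : S₀, ((W.localPolynomialAt (v : IsDedekindDomain.HeightOneSpectrum (NumberField.RingOfIntegers ℚ))).map (Int.castRingHom (PadicAlgCl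 2))).coeff (k v) * ((Rat.HeightOneSpectrum.natGenerator (v : IsDedekindDomain.HeightOneSpectrum (NumberField.RingOfIntegers ℚ)) : PadicAlgCl 2)⁻¹) ^ (k v)) * algebraMap ℚ (PadicAlgCl 2) (ratPlusSymbol f (r * ((∏ v : S₀, Rat.HeightOneSpectrum.natGenerator (v : IsDedekindDomain.HeightOneSpectrum (NumberField.RingOfIntegers ℚ)) ^ (k v) : ℕ) : ℚ))))‖ ≤ ‖(∑ k ∈ Fintype.piFinset (fun _ : S₀ ↦ Finset.range 3), (∏ v : S₀, ((W.localPolynomialAt (v : IsDedekindDomain.HeightOneSpectrum (NumberField.RingOfIntegers ℚ))).map (Int.castRingHom (PadicAlgCl 2))).coeff (k v) * ((Rat.HeightOneSpectrum.natGenerator (v : IsDedekindDomain.HeightOneSpectrum (NumberField.RingOfIntegers ℚ)) : PadicAlgCl 2)⁻¹) ^ (k v)) * algebraMap ℚ (PadicAlgCl 2) (ratPlusSymbol f ((((((Literature.NumberTheory.EllipticCurves.cyclotomicGenerator 2 : ZMod (2 ^ (n₁ + 2))) ^ s.val).val : ℚ) / (2 : ℚ) ^ (n₁ + 2))) * ((∏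 v : S₀, Rat.HeightOneSpectrum.natGenerator (v : IsDedekindDomain.HeightOneSpectrum (NumberField.RingOfIntegers ℚ)) ^ (k v) : ℕ) : ℚ))))‖ :=
  stub_curveDepletedSymbolMaxAtTwoPowerCusp_of_undepleted (curvePlusSymbolMax_iff_flatMuZeroAtTwo.mpr hflat)

/-- **THE CRUX `ThetaLayerLambdaCongruenceAtTwo` BY NAME from the seven named facts of skeleton v11 + Kμ⁺'s `FlatMuZeroAtTwo`**
(through w3 g3's `thetaLayerLambdaCongruenceAtTwo_of_facts_curveMax_deligne`, p605109, and g7's `stub_curveDepletedSymbolMaxAtTwoPowerCusp_of_undepleted`, p608093). Both research statements are hypotheses;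
BSD is not proved by this. [cite: GreenbergVatsal2000, §1 (10) and Prop. (2.4) (shape)] [cite: Pollack2003, Conj. 6.3] -/
theorem thetaLayerLambdaCongruenceAtTwo_of_facts_flatMuZeroAtTwo_deligne
    (hES : eichlerShimura_depletedOptimalQuotient_periodLattice_of_dvd)
    (hF : WeierstrassCurve.isIsogenous_iff_frobeniusTrace_eq) (hMK : mazurKenku_exists_cyclic_isogeny)
    (hSD : heckeSelfDual_torsionBy_J0) (hBz : buzzard2000_multiplicityOne_gamma0)
    (hSe : serre1972_supersingular_decompositionSubgroup_image)
    (hflat : ∀ (W : WeierstrassCurve ℚ) [W.IsElliptic] [W.IsGloballyMinimal], ¬ W.HasCM → W.analyticRank = 0 → Literature.NumberTheory.EllipticCurves.Rank1Residual.GoodSS W 2 → W.frobeniusTrace 2 = 0 → W.Δ < 0 → ∀ [NeZero (W.conductorNorm ℤ)] (f : CuspForm (CongruenceSubgroup.Gamma0 (W.conductorNorm ℤ)) 2), Literature.NumberTheory.EllipticCurves.ModularForms.IsNewformOf W f → ∀ (Lplus Lminus : Literature.NumberTheory.EllipticCurves.IwasawaAlgebra 2), Summit.BirchSwinnertonDyer.Rank1Residual.Supersingular.IsPollackPair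 f 2 Lplus Lminus → ¬ PowerSeries.C (2 : ℤ_[2]) ∣ Lminus)
    (hD : Deligne1974_heckeT_eigenvalue_norm_le) :
    Summit.BirchSwinnertonDyer.BirchSwinnertonDyer.Theses.ResidualThetaTransportAtTwo.ThetaLayerLambdaCongruenceAtTwo :=
  thetaLayerLambdaCongruenceAtTwo_of_facts_curveMax_deligne hES hF hMK hSD hBz hSe
    (stub_curveDepletedSymbolMaxAtTwoPowerCusp_of_flatMuZeroAtTwo hflat) hD

end Universal

end Summit.BirchSwinnertonDyer.BirchSwinnertonDyer.Theorems.ThetaLayerLambdaCongruenceAtTwo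

end
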